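import Summits.ABC.ABC.Theses.IneffectiveSubspace
import Summits.ABC.ABC.Theorems.DeepRegimeABC.Negative.WithoutEps
import Summits.ABC.ABC.Theorems.IneffectiveSubspaceDeepRegimeABCNormalForms
import Literature.Barriers.ABC.ExplicitABCQualityFloor
import Literature.NumberTheory.DiophantineGeometry.AbcImpliesHall

/-!
# Disproof of `DeepRegimeABC` (stmt-ABC-15121) — work file of the crux disprover

Crux (route `IneffectiveSubspace`, binder #3 of `closes`):
`DeepRegimeABC := ∀ ε > 0, ∃ K C, 0 < C ∧ ∀ abc triples with ω₅(abc) ≥ K, c < C·rad(abc)^(1+ε)`,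
`ω₅(n) := #{p : p⁵ ∣ n}`.

FINDINGS (cycle 1, 2026-08-16, refuter-cdisprove-stmt-ABC-15121-0):

* NO KILL. `ABC → DeepRegimeABC` (`deepRegimeABC_of_abc`, K := 0), so `¬DeepRegimeABC → ¬ABC`: an
  unconditional refutation is an abc DISPROOF — a family of abc triples with quality `≥ 1 + δ` and
  `ω₅ → ∞`.  Every printed `ω`-divergent family (Stewart–Tijdeman / van Frankenhuijsen smooth
  pigeonhole, Granville–Tucker `(1, N^{φ(r²)m} − 1, N^{φ(r²)m})`) has quality `→ 1`; the complete census
  of the 3504 abc hits with `c ≤ 10⁷` (Cruxes/DeepRegimeABC/Census-omega-r1-k1/k2.md) shows the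
  per-scale maximal quality DECREASING in `ω` beyond the modal cell.  So the crux resists for the same
  reason abc does, minus nothing usable: the deep tail is where every known engine is WEAKEST
  (`|S|`-cost in Ridout/Schlickewei, `C^ω` in Baker), but also where no counterexample mechanism lives.
* LANDED from this file (Theorems/DeepRegimeABC/Negative/, all ACCEPTED): WithoutCoprime.lean (p99909),
  UniformThreshold.lean (p101633), ConstFreeFloors.lean (p103570), InfiniteHits.lean (p111081),
  PolylogLoss.lean (p111139; Stewart–Tijdeman INSIDE every deep cell:
  `deepRegimeABC_false_with_polylog_loss : ∀ A : ℝ, ¬ ∃ K C, ∀ abc triples with ω₅ ≥ K,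
  c ≤ C·rad·(log c)^A` — the `ε` of the crux cannot be weakened to ANY polylog loss on ANY cell; proof =
  B–G Prop. 12.4.12 pigeonhole with modulus `N_K^{tf}` in place of `2^k`, units over `A+1` primes above
  `p_K`; to be imported/restated here once the farm has built it).
* (a) LOAD-BEARING HYPOTHESES, as theorems:
  - coprimality: `deepRegimeABC_false_without_coprime` (Negative/WithoutCoprime.lean, p99909):
    `(d, d, 2d)`, `d = N_K^m`, sits in every deep cell with `rad ≤ 2N_K` and `c → ∞`;
  - `ε > 0`: `Negative.deepRegimeABC_false_without_eps` (p90845, Granville–Tucker inside each cell);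
  - the depth threshold `K ≤ ω₅(abc)`: dropping it gives `ABC` VERBATIM (`withoutThreshold_iff_abc`) —
    it is the only separator between the crux and the summit;
  - positivity / `0 < C`: decoration (noted, nothing to land).
* (b) ORDER OF QUANTIFIERS is load-bearing: `∀ ε ∃ K C` cannot be commuted to `∃ K C ∀ ε`
  (`deepRegimeABC_not_uniform_in_eps`), and in the constant-free normal form
  (`deepRegimeABC_iff_constFree`, C = 1) the threshold MUST grow: `¬ ∃ K ∀ ε` (`constFree_threshold_unbounded`).
  Same for the line's `ω`-tail stub (`omegaTail_not_uniform_in_eps`).  Every cell carries INFINITELY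
  many hits `rad < c` (`deepCell_infinite_hits`, abc.S05 per cell), so this is about an infinite family
  per cell, not sporadic triples.  (Negative/UniformThreshold.lean p101633, InfiniteHits.lean p111081, PolylogLoss.lean p111139.)  [Contrast: with a constant
  `C(ε)` the uniform-`K` form `∃ K₀ ∀ ε ∃ C` is abc-complete by quintic breeding + Zsigmondy — open, ≡ ABC —
  not refutable; recorded as prose only.]
* (c) EXPLICIT FLOORS for the constant-free threshold `K₁(ε) := least K with c < rad^(1+ε) on {ω₅ ≥ K}`
  from verified record triples (kernel arithmetic, this file §c):
  `K₁(ε) ≥ 3` for `ε ≤ 0.6299` (Reyssat, `ω₅ = 2`), `K₁(ε) ≥ 4` for `ε ≤ 0.6234`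
  (`19·1307 + 7·29²·31⁸ = 2⁸·3²²·5⁴`, `ω₅ = 3`), `K₁(ε) ≥ 5` for `ε ≤ 0.5221`
  (`3¹⁸·23·2269 + 17³·29·31⁸ = 2¹⁰·5²·7¹⁵`, `ω₅ = 4`).  Compare: breeding reaches only `K < log₅(1/ε) < 1`
  here; Robert–Stewart–Tenenbaum Conj. A predicts `K(ε) ≍ ε⁻²/log²(1/ε)` (≈ 3–4 at ε = 0.52).
  (Negative/ConstFreeFloors.lean p103570.)  OPEN DATA QUESTION: records with `ω₅ ≥ 5` (needs de Smit's
  ABC@home list; none below `10⁷`; Dokchitser's LLL triple `71⁸233³ + 2⁵5¹⁸7³17³·981439 = 3³⁸13⁴·5233`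
  has `ω₅ = 4`, `q = 1.414`; van Frankenhuijsen's `5³ + 2⁹3¹⁷13² = 11⁵·17·31³·137` has `ω₅ = 3`, `q = 1.537`).
* (d) LINE `Sketch`: one stub `stub_omegaTailABC` ≡ crux (`deepRegimeABC_iff_omegaTail`, p96210); nothing
  strictly below the crux to break; `DeepRegimeABC_of` smuggles no gap (`ω₅ ≤ ω`).  Targets: none (no stuck
  stubs).  The (b)-lemmas are stated for the stub too.
* (e) NEAR-MISSES / not attempted in Lean.
  - ASYMPTOTIC FLOORS for `K₁(ε)` (C = 1 form).  Granville–Tucker inside cell `K` with a small prime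
    `r ∤ N_K` and `r^j ∣ N_K^n − 1`, `r^{j-1} > N_K`, gives `q − 1 ≳ 1/(N_K K² log K)`, i.e.
    `K₁(ε) ≥ (1 − o(1)) log(1/ε)/log log(1/ε)` (routine but long: primorial / nth-prime bounds).
    EXPECTED, NOT VERIFIED IN PRINT IN THIS FORM: Stewart–Tijdeman's smooth pigeonhole
    [StewartTijdeman1986; vanFrankenhuijsen2000; Bright, arXiv:2301.11056 Lemma 3.1] run with modulus
    `M ≍ (p_K#)⁵·n^{θn}` instead of `2^m` (S-units `b ≡ c (mod M)` over `n ≍ K log K` primes off `p_K#`,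
    `a = c − b`, box side `L ≍ M^{1/n}`) puts `K` deep primes in `a` at gain `log(c/rad) ≳ θ·n log n`
    against `log c ≍ n^{2+θ} log n`, so `q − 1 ≫ n^{−1−o(1)}` (θ ≍ 1/log n): `K₁(ε) ≥ ε^{−1+o(1)}` —
    POLYNOMIAL in `1/ε` (the landed `Negative/PolylogLoss.lean` is this mechanism with an unoptimised
    box, enough for every polylog but not for the exponent count).  Scale comparison for the
    planners: identities (Belyi breeding) reach `K ≤ log₅(1/ε)`; the C = 1 threshold is FORCED to
    `≥ ε^{-1+o(1)}`; RST Conj. A predicts `ε^{-2+o(1)}`.  So the crux's threshold necessarily lives at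
    polynomial scale in `1/ε`, far outside the reach of any quality-preserving identity — consistent
    with the route's claim that #6 is a genuine weakening of ABC "as far as identities can see", and a
    reason no costume reduction `DeepRegimeABC → ABC` by identities can exist.  (In the crux's own
    `C(ε)`-form no finite or `q → 1` family constrains `K(ε)`: for FIXED `K` every construction above has
    `q → 1`, as it must unless abc fails.)
  - `∃ K₀ ∀ ε ∃ C`-form (uniform threshold, constant allowed) ≡ ABC by quintic breeding + Zsigmondy:
    open, not refutable, not cheaply provable (no Zsigmondy in Mathlib).
  - No disproof candidate family exists in print or in the census: every `ω₅`-divergent family known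
    has quality `→ 1`; a refutation needs `lim inf q > 1` with `ω₅ → ∞`, i.e. `¬ABC`.
-/

-- `Summit.ABC.ABC…` is the mandated summit-side namespace (CONVENTIONS §2); the duplicate is deliberate.
set_option linter.dupNamespace false

namespace Summit.ABC.ABC.Cruxes.DeepRegimeABC.Disproof

open Literature.NumberTheory.DiophantineGeometry UniqueFactorizationMonoid Filter Topology
open Summit.ABC.ABC.Theses.IneffectiveSubspace
open Summit.ABC.ABC.Theorems.DeepRegimeABC
open Summit.ABC.ABC.Theorems.DeepRegimeABC.Negative

/-! ## (a) Load-bearing hypotheses -/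

/-- The crux with COPRIMALITY dropped (positivity and `a + b = c` kept). -/
def DeepRegimeABCWithoutCoprime : Prop :=
  ∀ ε : ℝ, 0 < ε → ∃ K : ℕ, ∃ C : ℝ, 0 < C ∧ ∀ a b c : ℕ, 0 < a → 0 < b → a + b = c →
    K ≤ ((a * b * c).primeFactors.filter (fun p => 5 ≤ (a * b * c).factorization p)).card →
    (c : ℝ) < C * ((rad a b c : ℕ) : ℝ) ^ (1 + ε)

/-- **Coprimality is load-bearing on every deep cell.** Without it, `(d, d, 2d)` with `d = N^m`,
`N = 2·p₀⋯p_{K−1}`, `m ≥ 5`, lies in the cell `{ω₅ ≥ K}`, has `rad(abc) ≤ 2N`, and `c = 2N^m → ∞`: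
already `ε = 1` fails. [folklore] -/
theorem deepRegimeABC_false_without_coprime : ¬ DeepRegimeABCWithoutCoprime := by
  intro h
  obtain ⟨K, C, hC, hKC⟩ := h 1 one_pos
  obtain ⟨h2N, hdvdN⟩ := deepModulus_spec K
  set N : ℕ := 2 * ∏ i ∈ Finset.range K, Nat.nth Nat.Prime i with hN
  -- exponent: m = t + 5 with 2^t > t ≥ 4·C·N²
  set t : ℕ := ⌈4 * C * (N : ℝ) ^ 2⌉₊ with ht
  set m : ℕ := t + 5 with hm
  set d : ℕ := N ^ m with hd
  have hNpos : 0 < N := by omega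
  have hdpos : 0 < d := pow_pos hNpos m
  have hlt := hKC d d (2 * d) hdpos hdpos (by ring) ?depth
  case depth =>
    have hne : d * d * (2 * d) ≠ 0 := by positivity
    refine le_card_deep_of_dvd hne hdvdN ?_
    calc N ^ 5 ∣ N ^ m := pow_dvd_pow N (by omega)
      _ ∣ d * d * (2 * d) := Dvd.intro (d * (2 * d)) (by rw [hd]; ring)
  -- rad(d·d·2d) ≤ 2N
  have hrad : rad d d (2 * d) ≤ 2 * N := by
    rw [rad_def]
    refine radical_le_of_dvd_pow (n := 3 * m) (by omega) ?_
    have h3m : 3 * m ≠ 0 := by omega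
    calc d * d * (2 * d) = 2 * N ^ (3 * m) := by rw [hd]; ring
      _ ∣ 2 ^ (3 * m) * N ^ (3 * m) := mul_dvd_mul (dvd_pow_self 2 h3m) dvd_rfl
      _ = (2 * N) ^ (3 * m) := (mul_pow 2 N (3 * m)).symm
  -- sizes in ℝ
  have hNR : (2 : ℝ) ≤ N := by exact_mod_cast h2N
  have hradR : ((rad d d (2 * d) : ℕ) : ℝ) ≤ 2 * N := by exact_mod_cast hrad
  have htR : 4 * C * (N : ℝ) ^ 2 ≤ t := Nat.le_ceil _
  have ht2 : (t : ℝ) < (2 : ℝ) ^ t := by exact_mod_cast Nat.lt_two_pow_self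
  have h2N : (2 : ℝ) ^ t ≤ (N : ℝ) ^ t := pow_le_pow_left₀ (by norm_num) hNR t
  have hNm : (N : ℝ) ^ t ≤ (N : ℝ) ^ m := pow_le_pow_right₀ (by linarith) (by omega)
  have hc : (((2 * d : ℕ)) : ℝ) = 2 * (N : ℝ) ^ m := by rw [hd]; push_cast; ring
  have key : C * ((rad d d (2 * d) : ℕ) : ℝ) ^ (1 + (1 : ℝ)) ≤ ((2 * d : ℕ) : ℝ) := by
    have h11 : (1 : ℝ) + 1 = ((2 : ℕ) : ℝ) := by norm_num
    rw [h11, Real.rpow_natCast, hc]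
    have hr0 : (0 : ℝ) ≤ ((rad d d (2 * d) : ℕ) : ℝ) := Nat.cast_nonneg _
    calc C * ((rad d d (2 * d) : ℕ) : ℝ) ^ 2 ≤ C * (2 * N) ^ 2 := by gcongr
      _ = 4 * C * (N : ℝ) ^ 2 := by ring
      _ ≤ t := htR
      _ ≤ (N : ℝ) ^ m := by linarith
      _ ≤ 2 * (N : ℝ) ^ m := by linarith [pow_nonneg (by linarith : (0 : ℝ) ≤ N) m]
  exact absurd hlt (not_lt.mpr key)

/-- The crux with the DEPTH THRESHOLD dropped is the summit statement verbatim. [folklore] -/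
theorem withoutThreshold_iff_abc :
    (∀ ε : ℝ, 0 < ε → ∃ C : ℝ, 0 < C ∧ ∀ a b c : ℕ, IsABCTriple a b c →
      (c : ℝ) < C * ((rad a b c : ℕ) : ℝ) ^ (1 + ε)) ↔ _root_.ABC :=
  Iff.rfl

/-! ## (b) The order of quantifiers is load-bearing: `(K, C)` must depend on `ε` -/

/-- **`∀ ε ∃ K C` cannot be commuted to `∃ K C ∀ ε`.** For every cell `K` and constant `C` there is an
abc triple in the cell with `C·rad(abc) < c` (`deepCell_no_uniform_constant`, Granville–Tucker inside
the cell); letting `ε → 0⁺` in `c < C·rad^(1+ε)` would give `c ≤ C·rad`. [folklore] -/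
theorem deepRegimeABC_not_uniform_in_eps :
    ¬ ∃ K : ℕ, ∃ C : ℝ, ∀ ε : ℝ, 0 < ε → ∀ a b c : ℕ, IsABCTriple a b c →
        K ≤ ((a * b * c).primeFactors.filter (fun p => 5 ≤ (a * b * c).factorization p)).card →
        (c : ℝ) < C * ((rad a b c : ℕ) : ℝ) ^ (1 + ε) := by
  rintro ⟨K, C, h⟩
  obtain ⟨a, b, c, habc, hK, hlt⟩ := deepCell_no_uniform_constant K C
  set r : ℝ := ((rad a b c : ℕ) : ℝ) with hr_def
  have hr : 0 < r := by
    rw [hr_def, rad_def]; exact_mod_cast Nat.radical_pos _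
  have hcont : Tendsto (fun ε : ℝ => C * r ^ (1 + ε)) (𝓝[>] 0) (𝓝 (C * r)) := by
    have hc : Continuous (fun ε : ℝ => C * r ^ (1 + ε)) :=
      continuous_const.mul (continuous_const.rpow (continuous_const.add continuous_id)
        (fun _ => Or.inl hr.ne'))
    have := (hc.tendsto 0).mono_left (nhdsWithin_le_nhds (s := Set.Ioi (0 : ℝ)))
    simpa using this
  have hev : ∀ᶠ ε in 𝓝[>] (0 : ℝ), (c : ℝ) ≤ C * r ^ (1 + ε) :=
    eventually_nhdsWithin_of_forall fun ε hε => (h ε hε a b c habc hK).le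
  have hle : (c : ℝ) ≤ C * r := ge_of_tendsto hcont hev
  exact absurd hle (not_le.mpr hlt)

/-- **In the constant-free normal form the threshold must grow without bound**: there is no single
cell `{ω₅ ≥ K}` on which `c < rad(abc)^(1+ε)` holds for EVERY `ε > 0`; i.e. the threshold function
`K₁(ε)` of `deepRegimeABC_iff_constFree` satisfies `K₁(ε) → ∞` as `ε → 0⁺`. [folklore] -/
theorem constFree_threshold_unbounded :
    ¬ ∃ K : ℕ, ∀ ε : ℝ, 0 < ε → ∀ a b c : ℕ, IsABCTriple a b c →
        K ≤ ((a * b * c).primeFactors.filter (fun p => 5 ≤ (a * b * c).factorization p)).card →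
        (c : ℝ) < ((rad a b c : ℕ) : ℝ) ^ (1 + ε) := by
  rintro ⟨K, h⟩
  exact deepRegimeABC_not_uniform_in_eps ⟨K, 1, fun ε hε a b c habc hK => by
    simpa using h ε hε a b c habc hK⟩

/-- The same two facts for the line's stub (`Lines/Sketch.lean: stub_omegaTailABC`, the `ω`-tail
form, ≡ crux by `deepRegimeABC_iff_omegaTail`): its `(W, C)` cannot be chosen independently of `ε`
either, because `{ω ≥ W} ⊇ {ω₅ ≥ W}`. [folklore] -/
theorem omegaTail_not_uniform_in_eps :
    ¬ ∃ W : ℕ, ∃ C : ℝ, ∀ ε : ℝ, 0 < ε → ∀ a b c : ℕ, IsABCTriple a b c →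
        W ≤ (a * b * c).primeFactors.card → (c : ℝ) < C * ((rad a b c : ℕ) : ℝ) ^ (1 + ε) := by
  rintro ⟨W, C, h⟩
  exact deepRegimeABC_not_uniform_in_eps
    ⟨W, C, fun ε hε a b c habc hK => h ε hε a b c habc (hK.trans (Finset.card_filter_le _ _))⟩

/-- **Every deep cell contains infinitely many abc hits** (`rad(abc) < c`, quality `> 1`): abc.S05
inside each cell, from `deepCell_no_uniform_constant` (the ratio `c/rad` is unbounded on the cell, so no
finite set of hits exhausts it).  So on no cell is the crux true for a trivial (cofinite) reason.
[cite: GranvilleTucker2002, p. 1227] -/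
theorem deepCell_infinite_hits (K : ℕ) :
    {t : ℕ × ℕ × ℕ | IsABCTriple t.1 t.2.1 t.2.2 ∧
      K ≤ ((t.1 * t.2.1 * t.2.2).primeFactors.filter
        (fun p => 5 ≤ (t.1 * t.2.1 * t.2.2).factorization p)).card ∧
      rad t.1 t.2.1 t.2.2 < t.2.2}.Infinite := by
  intro hfin
  set F := hfin.toFinset with hF
  set C : ℝ := (∑ t ∈ F, (t.2.2 : ℝ)) + 1 with hC
  have hC1 : (1 : ℝ) ≤ C := by
    have : (0 : ℝ) ≤ ∑ t ∈ F, (t.2.2 : ℝ) := Finset.sum_nonneg fun t _ => Nat.cast_nonneg _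
    linarith
  obtain ⟨a, b, c, habc, hK, hlt⟩ := deepCell_no_uniform_constant K C
  have hrad1 : (1 : ℝ) ≤ (rad a b c : ℝ) := by
    rw [rad_def]; exact_mod_cast Nat.radical_pos _
  have hhit : rad a b c < c := by
    have : (rad a b c : ℝ) < c := by nlinarith
    exact_mod_cast this
  have hmem : (a, b, c) ∈ F := by
    rw [hF, Set.Finite.mem_toFinset]
    exact ⟨habc, hK, hhit⟩
  have hcle : (c : ℝ) ≤ ∑ t ∈ F, (t.2.2 : ℝ) :=
    Finset.single_le_sum (f := fun t : ℕ × ℕ × ℕ => (t.2.2 : ℝ)) (fun t _ => Nat.cast_nonneg _) hmem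
  have : (c : ℝ) < c :=
    calc (c : ℝ) ≤ ∑ t ∈ F, (t.2.2 : ℝ) := hcle
      _ < C := by linarith
      _ ≤ C * (rad a b c : ℝ) := le_mul_of_one_le_right (by linarith) hrad1
      _ < c := hlt
  exact lt_irrefl _ this

/-! ## (c) Explicit floors for the constant-free threshold `K₁(ε)`

`ConstFreeCell K ε` := "`c < rad(abc)^(1+ε)` for every abc triple with `ω₅(abc) ≥ K`"; the crux is
`∀ ε > 0, ∃ K, ConstFreeCell K ε` (`deepRegimeABC_iff_constFree`).  Each record triple of depth count
`ω₅ = K₀` and quality `q` refutes `ConstFreeCell K ε` for all `K ≤ K₀`, `ε ≤ q − 1`. -/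

/-- Constant-free abc with exponent `1 + ε` on the cell `{ω₅(abc) ≥ K}`. -/
def ConstFreeCell (K : ℕ) (ε : ℝ) : Prop :=
  ∀ a b c : ℕ, IsABCTriple a b c →
    K ≤ ((a * b * c).primeFactors.filter (fun p => 5 ≤ (a * b * c).factorization p)).card →
    (c : ℝ) < ((rad a b c : ℕ) : ℝ) ^ (1 + ε)

/-- Cells are nested: a floor at `K` is a floor at every `K' ≤ K`. [folklore] -/
theorem ConstFreeCell.mono {K K' : ℕ} {ε : ℝ} (h : ConstFreeCell K' ε) (hK : K' ≤ K) :
    ConstFreeCell K ε :=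
  fun a b c habc hKle => h a b c habc (hK.trans hKle)

/-- Generic floor extraction: an abc triple `(a,b,c)` with `ω₅ ≥ K`, `rad ≤ R`, `2 ≤ R` and
`R^P < c^Q` (naturals, `0 < Q`) refutes `ConstFreeCell K ε` for every `ε ≤ P/Q − 1`. [folklore] -/
theorem not_constFreeCell_of_witness {a b c K R P Q : ℕ} (habc : IsABCTriple a b c)
    (hK : K ≤ ((a * b * c).primeFactors.filter (fun p => 5 ≤ (a * b * c).factorization p)).card)
    (hR : rad a b c ≤ R) (hR2 : 2 ≤ R) (hQ : 0 < Q) (hpow : R ^ P < c ^ Q) {ε : ℝ}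
    (hε : ε ≤ (P : ℝ) / Q - 1) : ¬ ConstFreeCell K ε := by
  intro h
  have hlt := h a b c habc hK
  -- c < rad^(1+ε) ≤ R^(1+ε) ≤ R^(P/Q), hence c^Q < R^P: contradiction with hpow
  have hradR : ((rad a b c : ℕ) : ℝ) ≤ R := by exact_mod_cast hR
  have hrad0 : (0 : ℝ) ≤ ((rad a b c : ℕ) : ℝ) := Nat.cast_nonneg _
  have hR1 : (1 : ℝ) ≤ (R : ℝ) := by exact_mod_cast (by omega : 1 ≤ R)
  have hQR : (0 : ℝ) < Q := by exact_mod_cast hQ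
  have hε1 : 0 ≤ 1 + ε := by
    -- if `1 + ε < 0` then `rad^(1+ε) ≤ 1 ≤ c`, contradicting `hlt`
    by_contra hneg
    have hneg : 1 + ε < 0 := not_le.mp hneg
    have hc1 : (1 : ℝ) ≤ c := by
      obtain ⟨ha, hb, hsum, -⟩ := habc
      exact_mod_cast (show 1 ≤ c by omega)
    have hrad1 : (1 : ℝ) ≤ ((rad a b c : ℕ) : ℝ) := by
      rw [rad_def]; exact_mod_cast Nat.radical_pos _
    have : ((rad a b c : ℕ) : ℝ) ^ (1 + ε) ≤ 1 :=
      Real.rpow_le_one_of_one_le_of_nonpos hrad1 hneg.le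
    linarith
  have h1 : (c : ℝ) < (R : ℝ) ^ ((P : ℝ) / Q) :=
    calc (c : ℝ) < ((rad a b c : ℕ) : ℝ) ^ (1 + ε) := hlt
      _ ≤ (R : ℝ) ^ (1 + ε) := Real.rpow_le_rpow hrad0 hradR hε1
      _ ≤ (R : ℝ) ^ ((P : ℝ) / Q) := Real.rpow_le_rpow_of_exponent_le hR1 (by linarith)
  have hc0 : (0 : ℝ) ≤ c := Nat.cast_nonneg _
  have h2 : (c : ℝ) ^ (Q : ℝ) < ((R : ℝ) ^ ((P : ℝ) / Q)) ^ (Q : ℝ) :=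
    Real.rpow_lt_rpow hc0 h1 hQR
  rw [← Real.rpow_mul (by linarith), div_mul_cancel₀ _ hQR.ne', Real.rpow_natCast,
    Real.rpow_natCast] at h2
  have h3 : (R : ℝ) ^ P < (c : ℝ) ^ Q := by exact_mod_cast hpow
  linarith

/-! ### Reyssat: `2 + 3¹⁰·109 = 23⁵`, `ω₅ = 2`, quality `1.62991…` -/

theorem two_le_depth_reyssat :
    2 ≤ ((2 * (3 ^ 10 * 109) * 23 ^ 5).primeFactors.filter
      (fun p => 5 ≤ (2 * (3 ^ 10 * 109) * 23 ^ 5).factorization p)).card := by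
  have hne : 2 * (3 ^ 10 * 109) * 23 ^ 5 ≠ 0 := by norm_num
  have h3 := mem_deep_of_pow_dvd hne (by norm_num : Nat.Prime 3) (by norm_num)
  have h23 := mem_deep_of_pow_dvd hne (by norm_num : Nat.Prime 23) (by norm_num)
  calc 2 = ({3, 23} : Finset ℕ).card := by rfl
    _ ≤ _ := Finset.card_le_card (by
      intro p hp
      simp only [Finset.mem_insert, Finset.mem_singleton] at hp
      rcases hp with rfl | rfl <;> assumption)

/-- `K₁(ε) ≥ 3` for `ε ≤ 0.6299`: Reyssat's triple sits in the cell `ω₅ ≥ 2`.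
[cite: BombieriGubler2006, Ex. 12.4.14] -/
theorem not_constFreeCell_two {ε : ℝ} (hε : ε ≤ 0.6299) : ¬ ConstFreeCell 2 ε := by
  refine not_constFreeCell_of_witness (R := 15042) (P := 16299) (Q := 10000)
    Literature.Barriers.ABC.reyssat_isABCTriple two_le_depth_reyssat
    (le_of_eq Literature.Barriers.ABC.rad_reyssat) (by norm_num) (by norm_num)
    Literature.Barriers.ABC.reyssat_pow_lt ?_
  norm_num at hε ⊢; linarith


/-! ### Browkin–Brzeziński: `19·1307 + 7·29²·31⁸ = 2⁸·3²²·5⁴`, `ω₅ = 3` (`2, 3, 31`), quality `1.62349…` -/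

/-- The Browkin–Brzeziński triple is an abc triple. [cite: Nitaj1996, §2 (table of good abc examples)] -/
theorem bb_isABCTriple : IsABCTriple (19 * 1307) (7 * 29 ^ 2 * 31 ^ 8) (2 ^ 8 * 3 ^ 22 * 5 ^ 4) := by
  refine ⟨by norm_num, by norm_num, by norm_num, ?_⟩
  norm_num [Nat.coprime_iff_gcd_eq_one]

/-- Its radical is at most `2·3·5·7·19·29·31·1307 = 4688222070` (`abc ∣ 4688222070²²`). [folklore] -/
theorem rad_bb_le :
    rad (19 * 1307) (7 * 29 ^ 2 * 31 ^ 8) (2 ^ 8 * 3 ^ 22 * 5 ^ 4) ≤ 4688222070 := by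
  rw [rad_def]
  exact radical_le_of_dvd_pow (n := 22) (by norm_num) (by norm_num)

theorem three_le_depth_bb :
    3 ≤ ((19 * 1307 * (7 * 29 ^ 2 * 31 ^ 8) * (2 ^ 8 * 3 ^ 22 * 5 ^ 4)).primeFactors.filter
      (fun p => 5 ≤ (19 * 1307 * (7 * 29 ^ 2 * 31 ^ 8) * (2 ^ 8 * 3 ^ 22 * 5 ^ 4)).factorization
        p)).card := by
  have hne : 19 * 1307 * (7 * 29 ^ 2 * 31 ^ 8) * (2 ^ 8 * 3 ^ 22 * 5 ^ 4) ≠ 0 := by norm_num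
  have h2 := mem_deep_of_pow_dvd hne (by norm_num : Nat.Prime 2) (by norm_num)
  have h3 := mem_deep_of_pow_dvd hne (by norm_num : Nat.Prime 3) (by norm_num)
  have h31 := mem_deep_of_pow_dvd hne (by norm_num : Nat.Prime 31) (by norm_num)
  calc 3 = ({2, 3, 31} : Finset ℕ).card := by rfl
    _ ≤ _ := Finset.card_le_card (by
      intro p hp
      simp only [Finset.mem_insert, Finset.mem_singleton] at hp
      rcases hp with rfl | rfl | rfl <;> assumption)

set_option exponentiation.threshold 20000 in
/-- `4688222070^16234 < (2⁸·3²²·5⁴)^10000`, i.e. quality `> 1.6234` (kernel integer arithmetic).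
[folklore] -/
theorem bb_pow_lt : (4688222070 : ℕ) ^ 16234 < (2 ^ 8 * 3 ^ 22 * 5 ^ 4) ^ 10000 := by
  decide

/-- `K₁(ε) ≥ 4` for `ε ≤ 0.6234`: the Browkin–Brzeziński triple sits in the cell `ω₅ ≥ 3`.
[cite: Nitaj1996, §2 (table of good abc examples)] -/
theorem not_constFreeCell_three {ε : ℝ} (hε : ε ≤ 0.6234) : ¬ ConstFreeCell 3 ε := by
  refine not_constFreeCell_of_witness (R := 4688222070) (P := 16234) (Q := 10000)
    bb_isABCTriple three_le_depth_bb rad_bb_le (by norm_num) (by norm_num) bb_pow_lt ?_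
  norm_num at hε ⊢; linarith

/-! ### Nitaj: `3¹⁸·23·2269 + 17³·29·31⁸ = 2¹⁰·5²·7¹⁵`, `ω₅ = 4` (`2, 3, 7, 31`), quality `1.52216…` -/

/-- Nitaj's triple is an abc triple. [cite: Nitaj1996, §2 (table of good abc examples)] -/
theorem nitaj_isABCTriple :
    IsABCTriple (3 ^ 18 * 23 * 2269) (17 ^ 3 * 29 * 31 ^ 8) (2 ^ 10 * 5 ^ 2 * 7 ^ 15) := by
  refine ⟨by norm_num, by norm_num, by norm_num, ?_⟩
  norm_num [Nat.coprime_iff_gcd_eq_one]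

/-- Its radical is at most `2·3·5·7·17·23·29·31·2269 = 167490523410` (`abc ∣ 167490523410¹⁸`).
[folklore] -/
theorem rad_nitaj_le :
    rad (3 ^ 18 * 23 * 2269) (17 ^ 3 * 29 * 31 ^ 8) (2 ^ 10 * 5 ^ 2 * 7 ^ 15) ≤ 167490523410 := by
  rw [rad_def]
  exact radical_le_of_dvd_pow (n := 18) (by norm_num) (by norm_num)

theorem four_le_depth_nitaj :
    4 ≤ ((3 ^ 18 * 23 * 2269 * (17 ^ 3 * 29 * 31 ^ 8) * (2 ^ 10 * 5 ^ 2 * 7 ^ 15)).primeFactors.filter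
      (fun p => 5 ≤ (3 ^ 18 * 23 * 2269 * (17 ^ 3 * 29 * 31 ^ 8) *
        (2 ^ 10 * 5 ^ 2 * 7 ^ 15)).factorization p)).card := by
  have hne : 3 ^ 18 * 23 * 2269 * (17 ^ 3 * 29 * 31 ^ 8) * (2 ^ 10 * 5 ^ 2 * 7 ^ 15) ≠ 0 := by
    norm_num
  have h2 := mem_deep_of_pow_dvd hne (by norm_num : Nat.Prime 2) (by norm_num)
  have h3 := mem_deep_of_pow_dvd hne (by norm_num : Nat.Prime 3) (by norm_num)
  have h7 := mem_deep_of_pow_dvd hne (by norm_num : Nat.Prime 7) (by norm_num)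
  have h31 := mem_deep_of_pow_dvd hne (by norm_num : Nat.Prime 31) (by norm_num)
  calc 4 = ({2, 3, 7, 31} : Finset ℕ).card := by rfl
    _ ≤ _ := Finset.card_le_card (by
      intro p hp
      simp only [Finset.mem_insert, Finset.mem_singleton] at hp
      rcases hp with rfl | rfl | rfl | rfl <;> assumption)

set_option exponentiation.threshold 20000 in
/-- `167490523410^15221 < (2¹⁰·5²·7¹⁵)^10000`, i.e. quality `> 1.5221` (kernel integer arithmetic).
[folklore] -/
theorem nitaj_pow_lt : (167490523410 : ℕ) ^ 15221 < (2 ^ 10 * 5 ^ 2 * 7 ^ 15) ^ 10000 := by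
  decide

/-- `K₁(ε) ≥ 5` for `ε ≤ 0.5221`: Nitaj's triple sits in the cell `ω₅ ≥ 4`.
[cite: Nitaj1996, §2 (table of good abc examples)] -/
theorem not_constFreeCell_four {ε : ℝ} (hε : ε ≤ 0.5221) : ¬ ConstFreeCell 4 ε := by
  refine not_constFreeCell_of_witness (R := 167490523410) (P := 15221) (Q := 10000)
    nitaj_isABCTriple four_le_depth_nitaj rad_nitaj_le (by norm_num) (by norm_num) nitaj_pow_lt ?_
  norm_num at hε ⊢; linarith

/-- **Reading for the crux.** In the constant-free normal form `∀ ε > 0 ∃ K, ConstFreeCell K ε`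
(`deepRegimeABC_iff_constFree`), any admissible threshold at `ε ≤ 0.5221` is `≥ 5`: the three record
triples above have `ω₅ = 2, 3, 4` and quality `> 1.6299, 1.6234, 1.5221`.  (Census below `10⁷`: the cell
`ω₅ = 4` holds 8 hits, record `(5⁷·37, 7⁵·19², 2¹²·3⁷)` of quality `1.3449`; no hit with `ω₅ ≥ 5` exists
below `10⁷`.)  Breeding-complete range at these `ε`: `K < log₅(1/ε) < 1`; RST Conj. A heuristic
`K(ε) ≍ ε⁻²/log²(1/ε)`. [cite: Nitaj1996, §2 (table of good abc examples)] -/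
theorem constFree_threshold_ge_five {ε : ℝ} (hε : ε ≤ 0.5221) {K : ℕ} (h : ConstFreeCell K ε) :
    5 ≤ K := by
  by_contra hK
  exact not_constFreeCell_four hε (h.mono (by omega))

end Summit.ABC.ABC.Cruxes.DeepRegimeABC.Disproof
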